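import Mathlib
import Summits.PneNP.PneNP.Theorems.OverlapGapAlgebraSolvableImpliesStableSectionMeanSquareFromMeanFilter
import Summits.PneNP.PneNP.Theorems.OverlapGapAlgebraSolvableImpliesStableSectionPurePeelingMean
import Summits.PneNP.PneNP.Theorems.OverlapGapAlgebraSolvableImpliesStableSectionPurePeelingRule
import Summits.PneNP.PneNP.Theorems.OverlapGapAlgebraSolvableImpliesStableSectionOffCore

/-!
# PneNP / OverlapGapAlgebra — crux `SolvableImpliesStableSection` (stmt-PneNP-2463):
# the PURE-LITERAL peeling block (5/5) — assembly: the crux's conclusion is TRUE for `k α < 2`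

Support for crux `stmt-PneNP-2463` (`Summit.PneNP.PneNP.Theses.OverlapGapAlgebra.SolvableImpliesStableSection`).

* `sissQ_conclusion_of_kalpha_lt_two` — **the f-free pure-literal peeling block.** For every `k ≥ 2`,
  every `α > 0` with `k α < 2`, all `η, ν > 0` and `c > 0`: for ALL large `n` (`m = ⌊α n⌋₊`) some
  section `g` is `νm`-valid at every splice point of the Bresler–Huang path and `ηn`-stable between
  consecutive splice points on at least `e^{-cn}·#paths` of the path tuples — the CONCLUSION of the crux
  at `(k, α, η, ν)`, with no solver.  The section is `R`-round parallel PURE-LITERAL peeling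
  (`(kα/2)^R ≤ ν/4`): it violates only surviving clauses (`sissQ_card_violated_le`), on average at most
  `((kα/2)^R + R²k/(2n))·m ≤ (ν/2)·m` of them (`sissQ_sum_card_alive_le`), and it is a radius-`R` local
  rule (`sissQ_local`); the engine from a mean bound (`sissMV_concl_of_localMean`) does the rest.  This
  is the direct argument for `α < 2/k` — exactly the range where the Bresler–Huang local simulation of
  Unit Clause (Prop. 8.1, `αk ≥ 2`) is not available.
* `sissQ_solvableImpliesStableSection_of_kalpha_lt_two` — the crux VERBATIM at `(k ≥ 2, α < 2/k, η, ν)`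
  (its hypothesis unused).
* `sissQ_solvableImpliesStableSection_off_core` — planner summary superseding
  `sissP_solvableImpliesStableSection_off_core`: the crux holds whenever
  `α < 2/k ∨ α ≥ 2^k log 2 ∨ η ≥ 1 ∨ ν > 2^{-k} ∨ ν > 2^{-k}(e^{kα2^{-k}} - 1)` (`k ≥ 3`).
No new definitions; axioms `propext`, `Classical.choice`, `Quot.sound`.
-/

set_option linter.dupNamespace false -- `Summit.PneNP.PneNP.…`: summit = sub-problem (D-0017)

namespace Summit.PneNP.PneNP.Theorems

open Finset Filter Asymptotics
open scoped Classical

section PureAssembly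

/-- **The pure-literal peeling block: the conclusion of `SolvableImpliesStableSection` holds for
`k α < 2`.** For every `k ≥ 2`, `α > 0` with `k α < 2`, all `η, ν > 0` and every `c > 0`: for all
large `n` (`m = ⌊α n⌋₊`) some map `g` (bounded-round pure-literal peeling) is `νm`-valid at every splice
point of the Bresler–Huang path and `ηn`-stable between consecutive splice points on at least
`e^{-cn}·#paths` of the path tuples `Ψ : Fin (k+1) → instances`. -/
theorem sissQ_conclusion_of_kalpha_lt_two (k : ℕ) (hk : 2 ≤ k) (α η ν : ℝ) (hα : 0 < α)
    (hkα : (k : ℝ) * α < 2) (hη : 0 < η) (hν : 0 < ν) (c : ℝ) (hc : 0 < c) :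
    ∀ᶠ n : ℕ in atTop, ∀ m : ℕ, m = ⌊α * n⌋₊ →
      ∃ g : (Fin m → Fin k → Fin n × Bool) → (Fin n → Bool),
        Real.exp (-(c * n)) * Fintype.card (Fin (k + 1) → Fin m → Fin k → Fin n × Bool) ≤
        ((Finset.univ.filter fun Ψ : Fin (k + 1) → Fin m → Fin k → Fin n × Bool =>
          let P : Fin k → ℕ → Fin m → Fin k → Fin n × Bool :=
            fun r q a b => if (a : ℕ) * k + b < q then Ψ r.succ a b else Ψ r.castSucc a b
          (∀ r : Fin k, ∀ q ≤ m * k, ((Finset.univ.filter fun i : Fin m =>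
            ∀ j, g (P r q) (P r q i j).1 ≠ (P r q i j).2).card : ℝ) ≤ ν * m) ∧
          ∀ r : Fin k, ∀ q < m * k,
            (hammingDist (g (P r q)) (g (P r (q + 1))) : ℝ) ≤ η * n).card : ℝ) := by
  have hk1 : 1 ≤ k := le_trans (by norm_num) hk
  have hk0R : (0 : ℝ) < k := by exact_mod_cast (lt_of_lt_of_le (by norm_num) hk : 0 < k)
  -- the number of rounds `R`: `(kα/2)^R ≤ ν/4`
  have hρ0 : 0 < (k : ℝ) * α / 2 := by positivity
  have hρ1 : (k : ℝ) * α / 2 < 1 := by linarith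
  obtain ⟨R, hR⟩ : ∃ R : ℕ, ((k : ℝ) * α / 2) ^ R < ν / 4 := exists_pow_lt_of_lt_one (by positivity) hρ1
  -- a fixed-point-free slot map (`k ≥ 2`)
  obtain ⟨dn, hdn⟩ : ∃ dn : Fin k → Fin k, ∀ u, dn u ≠ u := by
    refine ⟨fun u => if (u : ℕ) = 0 then ⟨1, by omega⟩ else ⟨0, by omega⟩, fun u h => ?_⟩
    by_cases hu : (u : ℕ) = 0
    · have := congrArg Fin.val h
      simp [hu] at this
    · have := congrArg Fin.val h
      simp [hu] at this
      exact hu this.symm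
  have j₀ : Fin k := ⟨0, by omega⟩
  refine sissMV_concl_of_localMean k R hk1 α η ν (ν / 2) hα hη (by linarith) ?_ c hc
  have hlarge : ∀ᶠ n : ℕ in atTop, 2 * (R : ℝ) ^ 2 * k / ν ≤ (n : ℝ) :=
    tendsto_natCast_atTop_atTop.eventually_ge_atTop _
  filter_upwards [eventually_ge_atTop 1, hlarge] with n hn1 hnlarge m hm
  have hnR : (1 : ℝ) ≤ n := by exact_mod_cast hn1
  have hnpos : (0 : ℝ) < n := by linarith
  have hm_le : (m : ℝ) ≤ α * n := by rw [hm]; exact Nat.floor_le (by positivity)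
  -- the pure-literal peeling rounds (opaque: only `h0`, `hstep` are used)
  obtain ⟨alive, h0, hstep⟩ : ∃ alive : ℕ → (Fin m → Fin k → Fin n × Bool) → Fin m → Prop,
      (∀ (Φ : Fin m → Fin k → Fin n × Bool) (i : Fin m), alive 0 Φ i) ∧
      (∀ (t : ℕ) (Φ : Fin m → Fin k → Fin n × Bool) (i : Fin m), alive (t + 1) Φ i ↔
        (alive t Φ i ∧ ∀ j : Fin k, ∃ i' : Fin m, alive t Φ i' ∧ i' ≠ i ∧
          ∃ j' : Fin k, Φ i' j' = ((Φ i j).1, !(Φ i j).2))) :=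
    ⟨fun t => Nat.rec (motive := fun _ => (Fin m → Fin k → Fin n × Bool) → Fin m → Prop)
        (fun _ _ => True)
        (fun _ al Φ i => al Φ i ∧ ∀ j : Fin k, ∃ i' : Fin m, al Φ i' ∧ i' ≠ i ∧
          ∃ j' : Fin k, Φ i' j' = ((Φ i j).1, !(Φ i j).2)) t,
      fun _ _ => trivial, fun _ _ _ => Iff.rfl⟩
  -- the pure-literal section (opaque: only `hg` is used)
  obtain ⟨g, hg⟩ : ∃ g : (Fin m → Fin k → Fin n × Bool) → (Fin n → Bool),
      ∀ (Φ : Fin m → Fin k → Fin n × Bool) (v : Fin n), g Φ v = true ↔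
        ∃ t, t < R ∧ ∃ i : Fin m, ∃ j : Fin k, alive t Φ i ∧
          (∀ i' : Fin m, alive t Φ i' → i' ≠ i → ∀ j' : Fin k,
            Φ i' j' ≠ ((Φ i j).1, !(Φ i j).2)) ∧
          Φ i j = (v, true) :=
    ⟨fun Φ v => decide (∃ t, t < R ∧ ∃ i : Fin m, ∃ j : Fin k, alive t Φ i ∧
        (∀ i' : Fin m, alive t Φ i' → i' ≠ i → ∀ j' : Fin k,
          Φ i' j' ≠ ((Φ i j).1, !(Φ i j).2)) ∧
        Φ i j = (v, true)), fun Φ v => by rw [decide_eq_true_iff]⟩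
  refine ⟨g, fun Φ Φ' v H => sissQ_local alive h0 hstep R g hg Φ Φ' v H, ?_⟩
  -- the mean violation: violated ⊆ alive after `R` rounds, first moment of the survivors
  have hmk : m * k ≤ 2 * n := by
    have h1 : ((m * k : ℕ) : ℝ) ≤ ((2 * n : ℕ) : ℝ) := by
      push_cast
      calc (m : ℝ) * k ≤ α * n * k := mul_le_mul_of_nonneg_right hm_le hk0R.le
        _ = (k * α) * n := by ring
        _ ≤ 2 * n := mul_le_mul_of_nonneg_right hkα.le hnpos.le
    exact_mod_cast h1
  have hV : ∀ Φ : Fin m → Fin k → Fin n × Bool,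
      ((((univ : Finset (Fin m)).filter fun i => ∀ j, g Φ (Φ i j).1 ≠ (Φ i j).2).card : ℕ) : ℝ)
        ≤ ((((univ : Finset (Fin m)).filter fun i => alive R Φ i).card : ℕ) : ℝ) := fun Φ => by
    exact_mod_cast sissQ_card_violated_le alive h0 hstep R g hg Φ
  have hmean := sissQ_sum_card_alive_le alive (fun Φ t i h => ((hstep t Φ i).1 h).2) dn hdn j₀ R
    hn1 hmk
  set N : ℝ := (Fintype.card (Fin m → Fin k → Fin n × Bool) : ℝ) with hN
  have hN0 : 0 ≤ N := Nat.cast_nonneg _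
  have hm0 : (0 : ℝ) ≤ m := Nat.cast_nonneg _
  have h2n : ((2 * n : ℕ) : ℝ) = 2 * n := by push_cast; ring
  have h2npos : (0 : ℝ) < 2 * n := by linarith
  -- numerics: `(mk/(2n))^R ≤ (kα/2)^R ≤ ν/4` and `R²k/(2n) ≤ ν/4`
  have hρle : ((m * k : ℕ) : ℝ) / ((2 * n : ℕ) : ℝ) ≤ k * α / 2 := by
    rw [h2n, div_le_iff₀ h2npos]
    push_cast
    calc (m : ℝ) * k ≤ α * n * k := mul_le_mul_of_nonneg_right hm_le hk0R.le
      _ = k * α / 2 * (2 * n) := by ring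
  have hρnn : 0 ≤ ((m * k : ℕ) : ℝ) / ((2 * n : ℕ) : ℝ) := by positivity
  have hpow : (((m * k : ℕ) : ℝ) / ((2 * n : ℕ) : ℝ)) ^ R ≤ ν / 4 :=
    (pow_le_pow_left₀ hρnn hρle R).trans hR.le
  have htail : (R : ℝ) ^ 2 * k / ((2 * n : ℕ) : ℝ) ≤ ν / 4 := by
    rw [h2n, div_le_iff₀ h2npos]
    have h := hnlarge
    rw [div_le_iff₀ hν] at h
    linarith only [h]
  calc (∑ Φ : Fin m → Fin k → Fin n × Bool,
        ((((univ : Finset (Fin m)).filter fun i => ∀ j, g Φ (Φ i j).1 ≠ (Φ i j).2).card : ℕ) : ℝ))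
      ≤ ∑ Φ : Fin m → Fin k → Fin n × Bool,
          ((((univ : Finset (Fin m)).filter fun i => alive R Φ i).card : ℕ) : ℝ) :=
        Finset.sum_le_sum fun Φ _ => hV Φ
    _ ≤ m * N * ((((m * k : ℕ) : ℝ) / ((2 * n : ℕ) : ℝ)) ^ R + (R : ℝ) ^ 2 * k / ((2 * n : ℕ) : ℝ)) :=
        hmean
    _ ≤ m * N * (ν / 4 + ν / 4) := by
        apply mul_le_mul_of_nonneg_left (add_le_add hpow htail) (by positivity)
    _ = ν / 2 * m * N := by ring

/-- **`SolvableImpliesStableSection` below density `2/k`.** For every `k ≥ 2`, `α > 0` with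
`k α < 2` and all `η, ν > 0`, the implication of the crux at `(k, α, η, ν)` holds — its conclusion is
true outright (`sissQ_conclusion_of_kalpha_lt_two`), the solver hypothesis is not used. -/
theorem sissQ_solvableImpliesStableSection_of_kalpha_lt_two (k : ℕ) (hk : 2 ≤ k) (α η ν : ℝ)
    (hα : 0 < α) (hkα : (k : ℝ) * α < 2) (hη : 0 < η) (hν : 0 < ν)
    (_hsolv : ∃ f : List Bool → List Bool, Literature.Computability.Complexity.IsPolyTime f ∧
      ∃ ε : ℝ, 0 < ε ∧ ∃ᶠ n : ℕ in Filter.atTop, ∀ m : ℕ, m = ⌊α * n⌋₊ → ε ≤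
        ((Finset.univ.filter fun Φ : Fin m → Fin k → Fin n × Bool => ∀ i, ∃ j,
          (f (Literature.Computability.Complexity.encodingCNF.encode (List.ofFn fun a =>
            List.ofFn fun b => (((Φ a b).1 : ℕ), (Φ a b).2)))).getD (Φ i j).1 false =
              (Φ i j).2).card : ℝ) / Fintype.card (Fin m → Fin k → Fin n × Bool))
    (c : ℝ) (hc : 0 < c) :
    ∃ᶠ n : ℕ in Filter.atTop, ∀ m : ℕ, m = ⌊α * n⌋₊ →
      ∃ g : (Fin m → Fin k → Fin n × Bool) → (Fin n → Bool),
        Real.exp (-(c * n)) * Fintype.card (Fin (k + 1) → Fin m → Fin k → Fin n × Bool) ≤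
        ((Finset.univ.filter fun Ψ : Fin (k + 1) → Fin m → Fin k → Fin n × Bool =>
          let P : Fin k → ℕ → Fin m → Fin k → Fin n × Bool :=
            fun r q a b => if (a : ℕ) * k + b < q then Ψ r.succ a b else Ψ r.castSucc a b
          (∀ r : Fin k, ∀ q ≤ m * k, ((Finset.univ.filter fun i : Fin m =>
            ∀ j, g (P r q) (P r q i j).1 ≠ (P r q i j).2).card : ℝ) ≤ ν * m) ∧
          ∀ r : Fin k, ∀ q < m * k,
            (hammingDist (g (P r q)) (g (P r (q + 1))) : ℝ) ≤ η * n).card : ℝ) :=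
  (sissQ_conclusion_of_kalpha_lt_two k hk α η ν hα hkα hη hν c hc).frequently

/-- **The crux off the (still smaller) core region.** For every `k ≥ 3` and `α, η, ν > 0` with `α < 2/k`
or `α ≥ 2^k log 2` or `η ≥ 1` or `ν > 2^{-k}` or `ν > 2^{-k}(e^{kα2^{-k}} - 1)`, the implication of
`SolvableImpliesStableSection` at `(k, α, η, ν)` holds. What remains of the crux is the core region
`{2/k ≤ α < 2^k log 2} ∩ {η < 1} ∩ {ν ≤ 2^{-k} min(1, e^{kα2^{-k}} - 1)}` — summit-strength inside the
Bresler–Huang window, f-free open below it (next target there: truncated Unit Clause, `αk ≥ 2`). -/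
theorem sissQ_solvableImpliesStableSection_off_core (k : ℕ) (hk : 3 ≤ k) (α η ν : ℝ) (hα : 0 < α)
    (hη : 0 < η) (hν : 0 < ν)
    (hoff : α < 2 / (k : ℝ) ∨ (2 : ℝ) ^ k * Real.log 2 ≤ α ∨ 1 ≤ η ∨ (1 / 2 : ℝ) ^ k < ν ∨
      (1 / 2 : ℝ) ^ k * (Real.exp (k * α * (1 / 2 : ℝ) ^ k) - 1) < ν)
    (hsolv : ∃ f : List Bool → List Bool, Literature.Computability.Complexity.IsPolyTime f ∧
      ∃ ε : ℝ, 0 < ε ∧ ∃ᶠ n : ℕ in Filter.atTop, ∀ m : ℕ, m = ⌊α * n⌋₊ → ε ≤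
        ((Finset.univ.filter fun Φ : Fin m → Fin k → Fin n × Bool => ∀ i, ∃ j,
          (f (Literature.Computability.Complexity.encodingCNF.encode (List.ofFn fun a =>
            List.ofFn fun b => (((Φ a b).1 : ℕ), (Φ a b).2)))).getD (Φ i j).1 false =
              (Φ i j).2).card : ℝ) / Fintype.card (Fin m → Fin k → Fin n × Bool))
    (c : ℝ) (hc : 0 < c) :
    ∃ᶠ n : ℕ in Filter.atTop, ∀ m : ℕ, m = ⌊α * n⌋₊ →
      ∃ g : (Fin m → Fin k → Fin n × Bool) → (Fin n → Bool),
        Real.exp (-(c * n)) * Fintype.card (Fin (k + 1) → Fin m → Fin k → Fin n × Bool) ≤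
        ((Finset.univ.filter fun Ψ : Fin (k + 1) → Fin m → Fin k → Fin n × Bool =>
          let P : Fin k → ℕ → Fin m → Fin k → Fin n × Bool :=
            fun r q a b => if (a : ℕ) * k + b < q then Ψ r.succ a b else Ψ r.castSucc a b
          (∀ r : Fin k, ∀ q ≤ m * k, ((Finset.univ.filter fun i : Fin m =>
            ∀ j, g (P r q) (P r q i j).1 ≠ (P r q i j).2).card : ℝ) ≤ ν * m) ∧
          ∀ r : Fin k, ∀ q < m * k,
            (hammingDist (g (P r q)) (g (P r (q + 1))) : ℝ) ≤ η * n).card : ℝ) := by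
  rcases hoff with hlow | hrest
  · have hk2 : 2 ≤ k := le_trans (by norm_num) hk
    have hk0R : (0 : ℝ) < k := by exact_mod_cast (lt_of_lt_of_le (by norm_num) hk : 0 < k)
    have hkα : (k : ℝ) * α < 2 := by
      have := (lt_div_iff₀ hk0R).1 hlow
      linarith only [this]
    exact sissQ_solvableImpliesStableSection_of_kalpha_lt_two k hk2 α η ν hα hkα hη hν hsolv c hc
  · exact Summit.PneNP.PneNP.Cruxes.SolvableImpliesStableSection.Sketch.solvableImpliesStableSection_off_core
      k hk α η ν hα hη hν (Or.inr hrest) hsolv c hc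

end PureAssembly

end Summit.PneNP.PneNP.Theorems
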